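/-
Copyright: cell pub-balaban-gaps, seat ne8 (estimate NE7c), gen 11. Project licence.
-/
import Summits.QuantumFields.BalabanUV.T4Continuum.Spine.NE7b.GaussianRankLocalMomentTower
import Summits.QuantumFields.BalabanUV.T4Continuum.Spine.NE7c.LiveFactorLCS

/-!
# Road (δ) ON A CONTINUUM MODEL: the NE7b lineage's one-step Gaussian tower as a THRESHOLD-PARAMETRIC TOWER FAMILY with
# assignment-free `branch` (C-ρ-TOWER by `rfl`), and junction J-3 (`sum_admS_integral_le_of_LCS_live`) FIRING on it
# (row NE7c; non-vacuity of J-2 ∧ J-3 on a genuine continuum object; kernel theorems)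

Cell `pub-balaban-gaps` (G2), seat ne8, estimate **NE7c** (`T4IndicatorShell.ShellWeightBound`; two-run artefact, NOT PRINTED in
[Bałaban 1983–89], NOT PROVED).  Twentieth proof-only file under `Spine/NE7c/`; nothing of the NE7b lineage edited — leaf-01 g78's
`GaussianRankLocalMomentTower` («the LCS road's MODEL INHABITANT OF RECORD», OWNER W-ne7bp1-g105-1) and file 15 `LiveFactorLCS` are
consumed BY NAME; nothing of Bałaban's is named or asserted; zero `sorry`.

WHY.  Road (δ)'s junction files pin the SHAPE of the (A1c-0) builder: a tower family indexed by the threshold assignment whose LABELS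
`branch` are assignment-free and whose step maps `op` carry the thresholds (C-ρ-TOWER; file 14 `LiveFactorTowerShell` §1, hypothesis
`hbr`), read at live letters by J-3 (file 15: extraction exponents `× λ₀²`, stability exponents free, ledger `× (λ₀² − κ)`).  So far
J-2 ∧ J-3 were shown jointly inhabited only by the tree's decided Dirac toy (`LocalConditionalStability` §5) and gen 8's unfiled
probes.  THIS FILE inhabits them with a CONTINUUM object already in the tree: leaf-01's one-step Gaussian tower `gaussTower B θ` on
`ι → ℝ` (level-0 density `e^{−xᵀAx}`, step = the positive partition `𝟙{θ ≤ xᵀBx} + 𝟙{θ > xᵀBx}`), read as the FAMILY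
`μ ↦ gaussTower B (μ²θ)` of lowered-threshold runs (`λ₀ ≤ μ`; quadratic dictionary `θ ↦ μ²θ` as files 17∕19).

WHAT IS PROVED ([folklore]):
* §1 `gaussTower_branch_eq` (`(gaussTower B θ).branch = (gaussTower B θ').branch` by `rfl` — the thresholds live in `op`, not in the
  labels: C-ρ-TOWER ON THE MODEL, file 14's `hbr` discharged), `admS_gaussTower_eq` (hence ONE pattern class for the whole family).
* §2 the live displays: `gauss_pointwiseExtraction_live` (at the tower `gaussTower B (μ²θ)` the pinned large-field event extracts the
  ASSIGNMENT-FREE exponent `λ₀²·δθ` — file 15's `pointwiseExtraction_live` on leaf-01's Chebyshev display; census class C1),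
  `gauss_locCondStability_live` (the stability display at EVERY live threshold with the SAME exponent `rank B·(−log(1−δ)∕2)` — the
  stability half is free, classes C2–C5).
* §3 `gauss_classWeight_le_live` — **J-3 FIRES ON THE MODEL**: file 15's `sum_admS_integral_le_of_LCS_live` BY NAME at the family member
  `gaussTower B (μ²θ)`, any `κ ≤ λ₀²` dominating the stability exponent (`rank B·(−log(1−δ)∕2) ≤ κ·δθ` — the model's located
  threshold-largeness clause), cost–volume constant `c₁ = δθ − rank B·(−log(1−δ)∕2)`: the pinned class weighs
  `≤ e^{−(λ₀² − κ)c₁}·∫e^{−xᵀAx}` for EVERY `μ ≥ λ₀`; `gaussian_largeField_peierls_ledger_live` (its closed form); and the direct form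
  `gaussian_largeField_peierls_live`: `∫ 𝟙{μ²θ ≤ xᵀBx} e^{−xᵀAx} ≤ e^{−(δλ₀²θ − rank B·(−log(1−δ)∕2))}·∫ e^{−xᵀAx}` — ONE exponent pair
  `(λ₀²·a, b)` for the whole family (leaf-01's `gaussian_largeField_peierls` at `μ²θ` + monotonicity).
* §4 a decided instance of the model clause.

NOT HERE (honest): Bałaban's tower (node O ∕ (A1c)); the four NE7c fields of the END's record on this model (the model has no second
run); anything of print.  BY-NAME EFFECT ON THE WALL: NONE — a non-vacuity ∕ currency check of the live junction on a continuum model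
(census row F-3).  VERDICT WORD UNCHANGED: WORK-bound behind node O; INSTANCE 0∕1.  NE7c ∕ NE7b NOT PRINTED ∕ NOT PROVED; spine PROVED
0∕9; rung (B)+1 on ONE finite T⁴ — NOT ℝ⁴, NOT infinite volume, NOT the mass gap, NOT Clay.
HONEST DEPENDENCY (cell): continuum YM on T⁴ ⇐ BetaPertH ∧ nine spine estimates (0∕9 proved); BetaPertH ⇐ (D1) ∧ (D4) ∧ CAP+tail.
-/

set_option autoImplicit false

namespace Summit.QuantumFields.BalabanUV.T4Continuum.Spine.NE7c.LiveFactorGaussTowerModel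

open MeasureTheory Real Matrix Finset
open Summit.QuantumFields.BalabanUV.T4Continuum.B16HistoryIndexedRepr
open Summit.QuantumFields.BalabanUV.T4Continuum.B16HistoryReprChain
open Summit.QuantumFields.BalabanUV.T4Continuum.NE7b.PrefixExtraction
open Summit.QuantumFields.BalabanUV.T4Continuum.NE7b.PrefixExtractionLaws
open Summit.QuantumFields.BalabanUV.T4Continuum.NE7b.LocalConditionalStability
open Summit.QuantumFields.BalabanUV.T4Continuum.NE7b.GaussianRankLocalMoment
open Summit.QuantumFields.BalabanUV.T4Continuum.NE7b.GaussianRankLocalMomentTower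
open Summit.QuantumFields.BalabanUV.T4Continuum.Spine.NE7c.LiveFactorLCS

variable {ι : Type} [Fintype ι] [DecidableEq ι]

/-! ## §1 The family `μ ↦ gaussTower B (μ²θ)` has an assignment-free `branch` (C-ρ-TOWER by `rfl`) -/

omit [DecidableEq ι] in
/-- **C-ρ-TOWER ON THE MODEL**: the labels of leaf-01's Gaussian tower do not see the threshold — `branch` is `univ` at every step for
every `θ`; only the step maps `op` (multiplication by `𝟙{θ ≤ xᵀBx}` ∕ its complement) carry it.  This is file 14's hypothesis `hbr`
(`LiveFactorTowerShell.towerShell_of_globalCompact`) for the family `μ ↦ gaussTower B (μ²θ)`, by `rfl`. [folklore] -/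
theorem gaussTower_branch_eq (B : Matrix ι ι ℝ) (θ θ' : ℝ) : (gaussTower B θ).branch = (gaussTower B θ').branch := rfl

omit [DecidableEq ι] in
/-- Hence ONE pattern class for the whole family: the pinned histories `admS (gaussTower B θ) pinLarge K` do not depend on `θ`
(`PrefixExtraction.admS_subset_admS` both ways). [folklore] -/
theorem admS_gaussTower_eq (B : Matrix ι ι ℝ) (θ θ' : ℝ) (K : ℕ) :
    admS (gaussTower B θ) pinLarge K = admS (gaussTower B θ') pinLarge K :=
  Finset.Subset.antisymm (admS_subset_admS (gaussTower B θ) (gaussTower B θ') pinLarge (fun _ _ _ h => h) K)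
    (admS_subset_admS (gaussTower B θ') (gaussTower B θ) pinLarge (fun _ _ _ h => h) K)

/-! ## §2 The two halves of «LCS-j» at a LIVE threshold `μ²θ`, `μ ≥ λ₀` -/

/-- The live letter arithmetic: `λ₀²·(δθ) ≤ δ·(μ²θ)` for `0 ≤ λ₀ ≤ μ`, `δ, θ ≥ 0`. [folklore] -/
theorem live_exponent_le {θ δ lam₀ μ : ℝ} (hθ : 0 ≤ θ) (hδ0 : 0 ≤ δ) (h0 : 0 ≤ lam₀) (hμ : lam₀ ≤ μ) :
    lam₀ ^ 2 * (δ * θ) ≤ δ * (μ ^ 2 * θ) := by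
  have h1 : lam₀ ^ 2 * (δ * θ) ≤ μ ^ 2 * (δ * θ) :=
    mul_le_mul_of_nonneg_right (pow_le_pow_left₀ h0 hμ 2) (mul_nonneg hδ0 hθ)
  linarith [h1]

omit [DecidableEq ι] in
/-- **THE EXTRACTION HALF AT A LIVE THRESHOLD** (census class C1 on the model): at the family member `gaussTower B (μ²θ)`, `μ ≥ λ₀ ≥ 0`,
the pinned large-field event extracts the ASSIGNMENT-FREE exponent `λ₀²·δθ` with leaf-01's carrier `e^{δxᵀBx}` — file 15's
`pointwiseExtraction_live` on `gauss_pointwiseExtraction`. [folklore] -/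
theorem gauss_pointwiseExtraction_live (B : Matrix ι ι ℝ) {θ δ lam₀ μ : ℝ} (hθ : 0 ≤ θ) (hδ0 : 0 ≤ δ) (h0 : 0 ≤ lam₀)
    (hμ : lam₀ ≤ μ) :
    PointwiseExtraction (gaussTower B (μ ^ 2 * θ)) pinLarge 1 (fun _ _ p => chi B (μ ^ 2 * θ) p)
      (fun _ _ x => exp (δ * (x ⬝ᵥ (B *ᵥ x)))) (fun _ _ => lam₀ ^ 2 * (δ * θ)) :=
  pointwiseExtraction_live (a₁ := fun _ _ => δ * θ) (fun _ _ _ => (exp_pos _).le)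
    (fun _ _ _ _ => live_exponent_le hθ hδ0 h0 hμ) (gauss_pointwiseExtraction B (μ ^ 2 * θ) hδ0)

/-- **THE STABILITY HALF AT EVERY LIVE THRESHOLD WITH THE SAME EXPONENT** (classes C2–C5 on the model: free): leaf-01's
`gauss_locCondStability` at the member `gaussTower B (μ²θ)` — the exponent `rank B·(−log(1−δ)∕2)` does not see `μ`. [folklore] -/
theorem gauss_locCondStability_live {A B : Matrix ι ι ℝ} (hA : A.PosDef) (hB : B.PosSemidef) (hAB : (A - B).PosSemidef)
    (θ μ : ℝ) {δ : ℝ} (hδ0 : 0 ≤ δ) (hδ1 : δ < 1) :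
    LocCondStability (gaussTower B (μ ^ 2 * θ)) pinLarge 1 (fun _ => (volume : Measure (ι → ℝ)))
      (fun x => exp (-(x ⬝ᵥ (A *ᵥ x)))) (fun _ _ x => exp (δ * (x ⬝ᵥ (B *ᵥ x))))
      (fun _ _ => (B.rank : ℝ) * (-Real.log (1 - δ) / 2)) :=
  gauss_locCondStability hA hB hAB (μ ^ 2 * θ) hδ0 hδ1

/-! ## §3 Junction J-3 fires on the model: the pinned class at every live threshold, ONE exponent table -/

omit [DecidableEq ι] in
/-- The stability exponent of the model is non-negative (`0 ≤ δ < 1`). [folklore] -/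
theorem stabilityExponent_nonneg (B : Matrix ι ι ℝ) {δ : ℝ} (hδ0 : 0 ≤ δ) (hδ1 : δ < 1) :
    0 ≤ (B.rank : ℝ) * (-Real.log (1 - δ) / 2) := by
  have hlog : Real.log (1 - δ) ≤ 0 := Real.log_nonpos (by linarith) (by linarith)
  exact mul_nonneg (Nat.cast_nonneg _) (by linarith)

/-- **J-3 ON THE MODEL — THE LEDGER FORM.**  File 15's `sum_admS_integral_le_of_LCS_live` BY NAME at the family member
`gaussTower B (μ²θ)` (`0 ≤ λ₀ ≤ μ`, `θ ≥ 0`, `0 ≤ δ < 1`): its `hstep ∕ hintχ ∕ PointwiseExtraction ∕ LocCondStability` are leaf-01's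
displays at `μ²θ`, the extraction profile `a₁ = δθ` is assignment-free (`λ₀²a₁ ≤ a`, §2), the stability exponent is dominated by
`κ·a₁` for a `κ ≤ λ₀²` (the model's located clause `hclause`), and the cost–volume constant is `c₁ = δθ − rank B·(−log(1−δ)∕2)`:
the pinned class weighs `≤ e^{−(λ₀² − κ)c₁} · ∫ e^{−xᵀAx}` — for EVERY member of the family.  (Non-trivial for `θ > 0`, `B ≠ 0`; at the
degenerate member `θ = 0` ∕ `B = 0` the «large-field» event is everything ∕ has rank `0` and the bound stays true — NE7b refuter g67's
zero-weight remark [NE7bREF-G67-WORD-F20].) [folklore] -/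
theorem gauss_classWeight_le_live {A B : Matrix ι ι ℝ} (hA : A.PosDef) (hB : B.PosSemidef) (hAB : (A - B).PosSemidef)
    {θ δ lam₀ μ κ : ℝ} (hθ : 0 ≤ θ) (hδ0 : 0 ≤ δ) (hδ1 : δ < 1) (h0 : 0 ≤ lam₀) (hμ : lam₀ ≤ μ) (hκ : κ ≤ lam₀ ^ 2)
    (hclause : (B.rank : ℝ) * (-Real.log (1 - δ) / 2) ≤ κ * (δ * θ)) :
    ∑ h ∈ admS (gaussTower B (μ ^ 2 * θ)) pinLarge 1,
        ∫ x, (gaussTower B (μ ^ 2 * θ)).eterm (fun x => exp (-(x ⬝ᵥ (A *ᵥ x)))) 1 h x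
          ∂(fun _ => (volume : Measure (ι → ℝ))) 1 ≤
      exp (-((lam₀ ^ 2 - κ) * (δ * θ - (B.rank : ℝ) * (-Real.log (1 - δ) / 2)))) *
        ∫ x, (fun x => exp (-(x ⬝ᵥ (A *ᵥ x)))) x ∂(fun _ => (volume : Measure (ι → ℝ))) 0 :=
  sum_admS_integral_le_of_LCS_live (T := gaussTower B (μ ^ 2 * θ)) (S := pinLarge) (μ := fun _ => volume) (K := 1)
    (χ := fun _ _ p => chi B (μ ^ 2 * θ) p) (a₁ := fun _ _ => δ * θ)
    (b := fun _ _ => (B.rank : ℝ) * (-Real.log (1 - δ) / 2))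
    trivial (fun x => (exp_pos _).le) (gauss_hstep B (μ ^ 2 * θ)) (gauss_hintχ hA B (μ ^ 2 * θ))
    (fun _ _ _ => (exp_pos _).le) (gauss_pointwiseExtraction B (μ ^ 2 * θ) hδ0)
    (gauss_locCondStability hA hB hAB (μ ^ 2 * θ) hδ0 hδ1) hκ (fun _ _ _ _ => live_exponent_le hθ hδ0 h0 hμ)
    (fun _ _ => stabilityExponent_nonneg B hδ0 hδ1) (fun _ _ => hclause) (fun h _ => by simp [sumAlong])

/-- **THE LEDGER FORM IN CLOSED FORM** (leaf-01's `gauss_classWeight_eq`: the pinned class is the one history `false`, its level-1 term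
`𝟙{μ²θ ≤ xᵀBx}·e^{−xᵀAx}`): `∫ 𝟙{μ²θ ≤ xᵀBx} e^{−xᵀAx} ≤ e^{−(λ₀² − κ)(δθ − rank B·(−log(1−δ)∕2))} · ∫ e^{−xᵀAx}` for every
`μ ≥ λ₀`. [folklore] -/
theorem gaussian_largeField_peierls_ledger_live {A B : Matrix ι ι ℝ} (hA : A.PosDef) (hB : B.PosSemidef)
    (hAB : (A - B).PosSemidef) {θ δ lam₀ μ κ : ℝ} (hθ : 0 ≤ θ) (hδ0 : 0 ≤ δ) (hδ1 : δ < 1) (h0 : 0 ≤ lam₀) (hμ : lam₀ ≤ μ)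
    (hκ : κ ≤ lam₀ ^ 2) (hclause : (B.rank : ℝ) * (-Real.log (1 - δ) / 2) ≤ κ * (δ * θ)) :
    ∫ x : ι → ℝ, chiLarge B (μ ^ 2 * θ) x * exp (-(x ⬝ᵥ (A *ᵥ x))) ≤
      exp (-((lam₀ ^ 2 - κ) * (δ * θ - (B.rank : ℝ) * (-Real.log (1 - δ) / 2)))) *
        ∫ x : ι → ℝ, exp (-(x ⬝ᵥ (A *ᵥ x))) := by
  have key := gauss_classWeight_le_live hA hB hAB hθ hδ0 hδ1 h0 hμ hκ hclause
  rwa [gauss_classWeight_eq] at key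

/-- **THE DIRECT FORM: ONE EXPONENT PAIR FOR THE WHOLE FAMILY.**  Leaf-01's `gaussian_largeField_peierls` at the live threshold `μ²θ`,
`μ ≥ λ₀ ≥ 0`, `θ, δ ≥ 0`: `∫ 𝟙{μ²θ ≤ xᵀBx} e^{−xᵀAx} ≤ e^{−(δ·λ₀²θ − rank B·(−log(1−δ)∕2))} · ∫ e^{−xᵀAx}` — the extracted exponent
carries `λ₀²` (C1), the volume cost `rank B·(−log(1−δ)∕2)` is untouched (C2–C5): file 17 §3's reading, here THROUGH the tower.
[folklore] -/
theorem gaussian_largeField_peierls_live {A B : Matrix ι ι ℝ} (hA : A.PosDef) (hB : B.PosSemidef) (hAB : (A - B).PosSemidef)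
    {θ δ lam₀ μ : ℝ} (hθ : 0 ≤ θ) (hδ0 : 0 ≤ δ) (hδ1 : δ < 1) (h0 : 0 ≤ lam₀) (hμ : lam₀ ≤ μ) :
    ∫ x : ι → ℝ, chiLarge B (μ ^ 2 * θ) x * exp (-(x ⬝ᵥ (A *ᵥ x))) ≤
      exp (-(δ * (lam₀ ^ 2 * θ) - (B.rank : ℝ) * (-Real.log (1 - δ) / 2))) * ∫ x : ι → ℝ, exp (-(x ⬝ᵥ (A *ᵥ x))) := by
  refine (gaussian_largeField_peierls hA hB hAB (μ ^ 2 * θ) hδ0 hδ1).trans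
    (mul_le_mul_of_nonneg_right (exp_le_exp.2 ?_) (integral_nonneg fun x => (exp_pos _).le))
  have h1 : lam₀ ^ 2 * (δ * θ) ≤ δ * (μ ^ 2 * θ) := live_exponent_le hθ hδ0 h0 hμ
  linarith

/-! ## §4 A decided instance of the model clause -/

/-- TOY: `rank B ≤ 1` (e.g. one site), `δ = 1∕2`, `λ₀ = 1∕2`, `κ = λ₀²∕2 = 1∕8`, `θ = 16`: the clause `rank B·(log 2)∕2 ≤ κ·δθ = 1` holds
since `log 2 < 1`. [folklore] -/
example (r : ℕ) (hr : r ≤ 1) : (r : ℝ) * (-Real.log (1 - 1 / 2) / 2) ≤ (1 / 8 : ℝ) * (1 / 2 * 16) := by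
  have hlog : Real.log 2 < 1 := by
    have := Real.log_two_lt_d9
    linarith
  have hr' : (r : ℝ) ≤ 1 := by exact_mod_cast hr
  have e : -Real.log (1 - 1 / 2) = Real.log 2 := by
    rw [show (1 : ℝ) - 1 / 2 = 2⁻¹ by norm_num, Real.log_inv, neg_neg]
  rw [e]
  have h2 : 0 ≤ Real.log 2 := Real.log_nonneg (by norm_num)
  nlinarith

end Summit.QuantumFields.BalabanUV.T4Continuum.Spine.NE7c.LiveFactorGaussTowerModel
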